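import Mathlib
import Literature.NumberTheory.Transcendental.AssociatorsBarEval
import Literature.NumberTheory.Transcendental.AssociatorsRegularisation
import HarnessLib

/-!
# Furusho's theorem: the pentagon equation implies the generalised double shuffle relation

Proof file for the named fact `furusho_pentagon_doubleShuffle` of `Associators.lean`
([Furusho2011, Thm 1.2]: a group-like solution `φ` of Drinfeld's pentagon equation over a field of
characteristic `0` satisfies the generalised double shuffle relation
`φ_*(u) φ_*(v) = Σ_{w ∈ u ∗ v} φ_*(w)`). The proof follows the architecture of [Furusho2011, §4–§5]
with the analysis (Chen's iterated integrals, the `KZ`-torsor) replaced by algebra: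

* `AssociatorsRegularisation.lean` (the `T`-free form of [Furusho2011, §4, (I.1)–(I.2)]):
  `NCSeries.generalisedDoubleShuffle_of_piY` reduces the relation for `φ_* = exp(…) π_Y(φ)` to the
  stuffle relation of `π_Y(φ)` for admissible indices together with the vanishing of
  `Σ_{w ∈ s ∗ 1ˡ} π_Y(φ)(w)` for admissible nonempty `s`;
* `AssociatorsBar.lean`, `AssociatorsBarIntegrable.lean` ([Furusho2011, §3–§4]): the bar elements
  `l^x, l^y, l^{xy}, l^{x,y}` of `V(M_{0,5})`, their integrability and the series shuffle formula;
* `AssociatorsEval.lean`, `AssociatorsTwoCycle.lean`, `AssociatorsPairing.lean`,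
  `AssociatorsBarEval.lean` ([Furusho2011, §5] with [Furusho2010, Lemmas 5–6]): the evaluation of
  the bar elements at `φ₄₅₁ φ₁₂₃` and `NCSeries.DrinfeldPentagon.piY_mul_piY_eq_sum_stuffle`, the
  stuffle relation of `π_Y(φ)` off the corner, which gives both inputs of the reduction (for
  `t = 1ˡ` the left-hand side vanishes because `c_{X₁ˡ}(φ) = 0`).

## References

* H. Furusho, *Double shuffle relation for associators*, Ann. of Math. 174 (2011), 341–360,
  Thm 1.2, §4–§5. [Furusho2011]
* H. Furusho, *Pentagon and hexagon equations*, Ann. of Math. 171 (2010), 545–556, Lemmas 5, 6.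
  [Furusho2010]
-/

noncomputable section

namespace Literature.NumberTheory.Transcendental

open NCSeries

/-- **Furusho's theorem [Furusho2011, Thm 1.2]: a group-like solution of Drinfeld's pentagon
equation over a field of characteristic `0` satisfies the generalised double shuffle relation.**
Discharge of the named fact `furusho_pentagon_doubleShuffle`. [cite: Furusho2011, Thm 1.2] -/
theorem furusho_pentagon_doubleShuffle_holds : furusho_pentagon_doubleShuffle := by
  intro k _ _ φ hg h5
  have h0 : φ [] = 1 := hg.1
  have hX1 : φ [true] = 0 := h5.apply_letter_eq_zero_of_isGroupLike hg true
  have h1 : ∀ j, 1 ≤ j → φ (List.replicate j true) = 0 := fun j hj =>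
    hg.apply_replicate_eq_zero hX1 j (by omega)
  refine generalisedDoubleShuffle_of_piY h0 h1 (fun s t hs ht => ?_) fun s hs hs0 l hl => ?_
  · by_cases hs0 : s = []
    · subst hs0; simp [h0]
    by_cases ht0 : t = []
    · subst ht0; simp [h0]
    exact h5.piY_mul_piY_eq_sum_stuffle hg hs hs0 ht.1 ht0
  · rw [← h5.piY_mul_piY_eq_sum_stuffle hg hs hs0 (t := List.replicate l 1)
      (fun i hi => by rw [List.eq_of_mem_replicate hi]) (by simpa using Nat.one_le_iff_ne_zero.mp hl),
      piY_apply_replicate_one, h1 l hl, mul_zero, mul_zero]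

/-- **Furusho's theorem over an arbitrary commutative `ℚ`-algebra** [Furusho2011, Thm 1.2]: a
group-like solution `φ ∈ R⟨⟨X₀, X₁⟩⟩` of Drinfeld's pentagon equation satisfies the generalised
double shuffle relation `Δ_*(φ_*) = φ_* ⊗̂ φ_*`, for EVERY commutative `ℚ`-algebra `R` (not only a
field of characteristic `0`, the printed hypothesis of [Furusho2011, §2]). Furusho's proof is a
chain of polynomial identities in the coefficients of `φ` and runs verbatim over any commutative
`ℚ`-algebra; concretely, the tree's proof of `furusho_pentagon_doubleShuffle_holds` only ever uses
`[CommRing R] [Algebra ℚ R]` (`generalisedDoubleShuffle_of_piY`,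
`NCSeries.DrinfeldPentagon.piY_mul_piY_eq_sum_stuffle`), and the same script is repeated here with
the field binder replaced by a commutative `ℚ`-algebra. Scheme-theoretically: the closed subscheme
`Pent ∩ GroupLike` of the non-commutative power-series scheme lies in `DMR` as SCHEMES over `ℚ`,
not merely on reduced points — so Furusho's transfer needs no reducedness of the coefficient ring.
[cite: Furusho2011, Thm 1.2] -/
theorem NCSeries.DrinfeldPentagon.generalisedDoubleShuffle {R : Type*} [CommRing R] [Algebra ℚ R]
    {φ : NCSeries Bool R} (h5 : DrinfeldPentagon φ) (hg : IsGroupLike φ) :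
    GeneralisedDoubleShuffle φ := by
  have h0 : φ [] = 1 := hg.1
  have hX1 : φ [true] = 0 := h5.apply_letter_eq_zero_of_isGroupLike hg true
  have h1 : ∀ j, 1 ≤ j → φ (List.replicate j true) = 0 := fun j hj =>
    hg.apply_replicate_eq_zero hX1 j (by omega)
  refine generalisedDoubleShuffle_of_piY h0 h1 (fun s t hs ht => ?_) fun s hs hs0 l hl => ?_
  · by_cases hs0 : s = []
    · subst hs0; simp [h0]
    by_cases ht0 : t = []
    · subst ht0; simp [h0]
    exact h5.piY_mul_piY_eq_sum_stuffle hg hs hs0 ht.1 ht0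
  · rw [← h5.piY_mul_piY_eq_sum_stuffle hg hs hs0 (t := List.replicate l 1)
      (fun i hi => by rw [List.eq_of_mem_replicate hi]) (by simpa using Nat.one_le_iff_ne_zero.mp hl),
      piY_apply_replicate_one, h1 l hl, mul_zero, mul_zero]

/-- **Furusho's theorem over commutative `ℚ`-algebras, binder form**: for every commutative
`ℚ`-algebra `R` and every group-like `φ ∈ R⟨⟨X₀, X₁⟩⟩` satisfying Drinfeld's pentagon equation,
the generalised double shuffle relation holds. This is the statement
`furusho_pentagon_doubleShuffle` with `[Field k] [CharZero k]` weakened to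
`[CommRing R] [Algebra ℚ R]`. [cite: Furusho2011, Thm 1.2] -/
theorem furusho_pentagon_doubleShuffle_commRing (R : Type*) [CommRing R] [Algebra ℚ R]
    (φ : NCSeries Bool R) (hg : NCSeries.IsGroupLike φ) (h5 : NCSeries.DrinfeldPentagon φ) :
    NCSeries.GeneralisedDoubleShuffle φ :=
  h5.generalisedDoubleShuffle hg

end Literature.NumberTheory.Transcendental
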